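import Mathlib
import Literature.NumberTheory.Transcendental.LinEDS
import Literature.NumberTheory.Transcendental.LinEDSCode
import Summits.KontsevichZagierPeriods.KontsevichZagierPeriods.Theorems.FurushoPentagonKernelModuloPeriodConjectureLeafOfOddDet
import Summits.KontsevichZagierPeriods.KontsevichZagierPeriods.Theorems.FurushoPentagonKernelModuloPeriodConjectureBlockDetOdd
import Summits.KontsevichZagierPeriods.KontsevichZagierPeriods.Theorems.FurushoPentagonKernelModuloPeriodConjectureElimLoopSound
import Summits.KontsevichZagierPeriods.KontsevichZagierPeriods.Theorems.FurushoPentagonKernelModuloPeriodConjectureOddDetAndSolve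
import HarnessLib

/-!
# `KernelModuloPeriodConjecture`, line `Sketch`: the leaf from a chain of block certificates

Crux `FurushoPentagon.KernelModuloPeriodConjecture` (stmt-KontsevichZagierPeriods-15058), line
`Sketch`, registered stub `stub_leaf_of_checkBlocks` (Stage 2 of lead c5): the BLOCK version of the
master soundness theorem of the kernel-checkable GF(2) rank engine (`LinEDS` §9). A chain of blocks
`(0, D₁], (D₁, D₂], …, (D_{B-1}, D_B]` of depths, each certified by one kernel run
`LinEDS.checkBlock k lo D names = true` (exactly as many valid names as columns of depth in
`(lo, D]`; no row has a bit at a column of depth `> D`; the rows masked to the block eliminate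
fully), with every column of weight `k` of depth `≤ D_B`, proves the weight-`k` slice of the
algebraic leaf. Assembly: the positions are the sigma type over the blocks; the integer relation
matrix is block lower triangular MODULO 2 (E9: a zero bit is an even entry) with odd diagonal block
determinants (E6 + E7 per block), hence has odd determinant (`stub_blockDet_odd`), and
`stub_leaf_of_oddDet` finishes.

References: K. Ihara, M. Kaneko, D. Zagier, Compos. Math. 142 (2006) §2 [IharaKanekoZagier2006].
-/

namespace Summit.KontsevichZagierPeriods.FurushoPentagon.KernelModuloPeriodConjecture

open Literature.NumberTheory.Transcendental
open Literature.NumberTheory.Transcendental.LinEDS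

/-! ### The small `§9` vocabulary -/

/-- `popc k c ≤ k`. [folklore] -/
theorem blocksE13_popc_le : ∀ k c : ℕ, LinEDS.popc k c ≤ k
  | 0, _ => by simp [LinEDS.popc]
  | k + 1, c => by
    rw [LinEDS.popc]
    have := blocksE13_popc_le k (c / 2)
    have : c % 2 ≤ 1 := by omega
    omega

/-- An odd code has positive depth (`1 ≤ k`). [folklore] -/
theorem blocksE13_popc_pos {k c : ℕ} (hk : 1 ≤ k) (hc : c % 2 = 1) : 1 ≤ LinEDS.popc k c := by
  obtain ⟨m, rfl⟩ : ∃ m, k = m + 1 := ⟨k - 1, by omega⟩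
  rw [LinEDS.popc]; omega

/-- Membership in `colsDepth`. [folklore] -/
theorem blocksE13_mem_colsDepth {k lo hi c : ℕ} :
    c ∈ LinEDS.colsDepth k lo hi ↔ c ∈ LinEDS.cols k ∧ lo < LinEDS.popc k c ∧ LinEDS.popc k c ≤ hi := by
  rw [LinEDS.colsDepth, List.mem_filter]
  simp [Nat.blt_eq, Nat.ble_eq]

/-- Bits of `maskOf`. [folklore] -/
theorem blocksE13_testBit_maskOf (L : List ℕ) (i : ℕ) :
    (LinEDS.maskOf L).testBit i = true ↔ i ∈ L := by
  rw [LinEDS.maskOf, colsE8_testBit_foldl_lor]; simp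

/-! ### Chains of blocks -/

/-- In a chain of blocks with `lo ≤ D`, an earlier block ends below where a later block starts.
[folklore] -/
theorem blocksE13_chain_mono : ∀ (bl : List (ℕ × ℕ)), bl.IsChain (fun p q => p.2 = q.1) →
    (∀ p ∈ bl, p.1 ≤ p.2) → ∀ (i j : Fin bl.length), i < j → (bl.get i).2 ≤ (bl.get j).1
  | [], _, _, i, _, _ => i.elim0
  | p :: bl', hc, hle, ⟨i, hi⟩, ⟨j, hj⟩, hij => by
    have hle' : ∀ q ∈ bl', q.1 ≤ q.2 := fun q hq => hle q (List.mem_cons_of_mem _ hq)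
    have hc' : bl'.IsChain (fun p q => p.2 = q.1) := List.IsChain.tail hc
    have IH := blocksE13_chain_mono bl' hc' hle'
    cases j with
    | zero => exact absurd hij (by simp)
    | succ j' =>
      have hj' : j' < bl'.length := by simpa using hj
      cases i with
      | zero =>
        -- `p.2 = (bl'.get 0).1 ≤ (bl'.get j').1`
        obtain ⟨q, bl'', rfl⟩ := List.exists_cons_of_ne_nil
          (show bl' ≠ [] from List.ne_nil_of_length_pos (by omega))
        have hpq : p.2 = q.1 := (List.isChain_cons_cons.mp hc).1
        show p.2 ≤ ((q :: bl'').get ⟨j', hj'⟩).1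
        rw [hpq]
        cases j' with
        | zero => exact le_rfl
        | succ j'' =>
          calc q.1 ≤ q.2 := hle' q (by simp)
            _ = ((q :: bl'').get ⟨0, by simp⟩).2 := rfl
            _ ≤ ((q :: bl'').get ⟨j'' + 1, hj'⟩).1 :=
              IH ⟨0, by simp⟩ ⟨j'' + 1, hj'⟩ (Fin.mk_lt_mk.mpr (by omega))
      | succ i' =>
        have hi' : i' < bl'.length := by simpa using hi
        exact IH ⟨i', hi'⟩ ⟨j', hj'⟩ (by simpa using hij)

/-- In a chain of blocks, every depth above the first `lo` and not above the last `D` falls in a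
block. [folklore] -/
theorem blocksE13_chain_cover : ∀ (bl : List (ℕ × ℕ)) (hne : bl ≠ []),
    bl.IsChain (fun p q => p.2 = q.1) → ∀ d : ℕ, (bl.head hne).1 < d → d ≤ (bl.getLast hne).2 →
      ∃ i : Fin bl.length, (bl.get i).1 < d ∧ d ≤ (bl.get i).2
  | [], hne, _, _, _, _ => absurd rfl hne
  | p :: bl', _, hc, d, hlo, hhi => by
    have IH := fun hne' h1 h2 => blocksE13_chain_cover bl' hne' (List.IsChain.tail hc) d h1 h2
    by_cases hd : d ≤ p.2
    · exact ⟨⟨0, by simp⟩, hlo, hd⟩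
    · have hne' : bl' ≠ [] := by
        rintro rfl
        exact hd (by simpa using hhi)
      have hpq : p.2 = (bl'.head hne').1 := by
        obtain ⟨q, bl'', rfl⟩ := List.exists_cons_of_ne_nil hne'
        exact (List.isChain_cons_cons.mp hc).1
      obtain ⟨⟨i, hi⟩, h1, h2⟩ := IH hne' (by rw [← hpq]; omega)
        (by rwa [List.getLast_cons hne'] at hhi)
      exact ⟨⟨i + 1, by simpa using hi⟩, h1, h2⟩

/-! ### One block: its diagonal integer block has odd determinant -/

/-- Unpacking a successful `checkBlock`. [folklore] -/
theorem blocksE13_checkBlock {k lo D : ℕ} {names : List (List ℕ × List ℕ)}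
    (h : LinEDS.checkBlock k lo D names = true) :
    names.length = (LinEDS.colsDepth k lo D).length ∧
      (∀ ν ∈ names, LinEDS.validName k ν = true) ∧
      (∀ ν ∈ names, LinEDS.rowBits k ν &&& LinEDS.maskOf (LinEDS.colsDepth k D k) = 0) ∧
      LinEDS.elimLoop (2 ^ (k - 1)) (LinEDS.rep (2 ^ (k - 1)) names.length) (LinEDS.colsDepth k lo D)
        (LinEDS.pack (2 ^ (k - 1))
          ((names.map (LinEDS.rowBits k)).map (· &&& LinEDS.maskOf (LinEDS.colsDepth k lo D)))) = true := by
  simp only [LinEDS.checkBlock, Bool.and_eq_true, List.all_eq_true, List.mem_map,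
    forall_exists_index, and_imp, forall_apply_eq_imp_iff₂, beq_iff_eq] at h
  obtain ⟨⟨⟨hlen, hval⟩, hno⟩, helim⟩ := h
  rw [sameLength_eq_true_iff] at hlen
  rw [lengthTR_eq_length] at helim
  exact ⟨hlen, hval, hno, helim⟩

/-- `List.ofFn` of a composite through `List.get` along a length cast is `List.map`. [folklore] -/
theorem blocksE13_ofFn_get {α β : Type*} (l : List α) (f : α → β) {n : ℕ} (h : n = l.length) :
    List.ofFn (fun x : Fin n => f (l.get (Fin.cast h x))) = l.map f := by
  subst h
  apply List.ext_get (by simp)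
  intro i h1 h2
  simp

/-- **The diagonal block is odd**: for a certified block, the integer matrix of its names against
its own columns has odd determinant (E6 on the masked rows, E9 parities, E7 (a)).
[cite: IharaKanekoZagier2006, §2] -/
theorem blocksE13_diag_odd {k lo D : ℕ} (hk : 2 ≤ k) {names : List (List ℕ × List ℕ)}
    (h : LinEDS.checkBlock k lo D names = true) (hlen : (LinEDS.colsDepth k lo D).length = names.length) :
    Odd (Matrix.of fun (x y : Fin (LinEDS.colsDepth k lo D).length) =>
      LinEDS.entry k (names.get (Fin.cast hlen x)) ((LinEDS.colsDepth k lo D).get y)).det := by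
  classical
  obtain ⟨-, hval, -, helim⟩ := blocksE13_checkBlock h
  obtain ⟨hpw, hcols, -, -⟩ := stub_cols_spec k hk
  set C := LinEDS.colsDepth k lo D with hC
  set mask := LinEDS.maskOf C with hmask
  have hCsub : ∀ c ∈ C, c ∈ LinEDS.cols k := fun c hc => (blocksE13_mem_colsDepth.mp hc).1
  have hCpw : C.Pairwise (· < ·) := by rw [hC, LinEDS.colsDepth]; exact hpw.filter _
  -- the masked rows and E6
  set rows := (names.map (LinEDS.rowBits k)).map (· &&& mask) with hrows
  have hW : 0 < 2 ^ (k - 1) := by positivity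
  have hmasklt : mask < 2 ^ 2 ^ (k - 1) := by
    refine Nat.lt_pow_two_of_testBit _ fun i hi => ?_
    cases hb : mask.testBit i
    · rfl
    · have := ((hcols i).mp (hCsub i ((blocksE13_testBit_maskOf C i).mp hb))).1; omega
  have hrowlt : ∀ r ∈ rows, r < 2 ^ 2 ^ (k - 1) := by
    intro r hr
    obtain ⟨r', -, rfl⟩ := List.mem_map.mp hr
    exact lt_of_le_of_lt Nat.and_le_right hmasklt
  have hrowslen : rows.length = names.length := by simp [hrows]
  have hpiv := stub_elimLoop_sound (2 ^ (k - 1)) rows C hW hrowlt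
    (fun c hc => ((hcols c).mp (hCsub c hc)).1) (by rw [hrowslen]; exact helim)
  -- E7 (a) on the block
  let row : Fin C.length → ℕ := fun x => LinEDS.rowBits k (names.get (Fin.cast hlen x)) &&& mask
  have hofFn : List.ofFn row = rows := by
    rw [hrows, List.map_map]
    exact blocksE13_ofFn_get names ((· &&& mask) ∘ LinEDS.rowBits k) hlen
  have hmono : StrictMono C.get := fun x y hxy => List.pairwise_iff_get.mp hCpw x y hxy
  refine stub_oddDet_and_solve.1 C.length row C.get hmono
    (fun y => hofFn ▸ hpiv (C.get y) (List.get_mem _ _)) _ fun x y => ?_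
  -- parities: masked bit = bit at a block column = parity of the entry (E9)
  have hy : C.get y ∈ C := List.get_mem _ _
  rw [Matrix.of_apply, ← (stub_rowBits_parity k _ (hval _ (List.get_mem _ _))).1 (C.get y) (hCsub _ hy)]
  show _ ↔ (LinEDS.rowBits k (names.get (Fin.cast hlen x)) &&& mask).testBit (C.get y) = true
  rw [Nat.testBit_land, (blocksE13_testBit_maskOf C _).mpr hy, Bool.and_true]

/-! ### The registered stub -/

/-- **The leaf from a chain of block certificates** (registered stub `stub_leaf_of_checkBlocks`,
lead c5 Stage 2; crux stmt-KontsevichZagierPeriods-15058, line `Sketch`). [cite: IharaKanekoZagier2006, Conjecture 1] -/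
theorem stub_leaf_of_checkBlocks :
    ∀ (k : ℕ) (bl : List (ℕ × ℕ)), 2 ≤ k → bl ≠ [] → (∀ p ∈ bl, p.1 ≤ p.2) →
      bl.head?.map Prod.fst = some 0 → bl.IsChain (fun p q => p.2 = q.1) →
      (∀ p ∈ bl, ∃ names, LinEDS.checkBlock k p.1 p.2 names = true) →
      LinEDS.depthCovered k ((bl.getLast?.map Prod.snd).getD 0) = true →
      ∀ s : List ℕ, MZV.IsAdmissible s → MZV.weight s = k →
        ∃ b : List ℕ →₀ ℚ, (∀ t ∈ b.support, MZV.IsHoffman t ∧ MZV.weight t = MZV.weight s) ∧ ∀ (R : Type) [CommRing R] [Algebra ℚ R] [IsReduced R] (φ : NCSeries Bool R), NCSeries.IsGroupLike φ → NCSeries.DrinfeldPentagon φ → φ (MZV.binaryWord s) = b.sum (fun t q => q • φ (MZV.binaryWord t)) := by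
  classical
  intro k bl hk hne hle hhead hchain hblocks hcov s hs hw
  -- choose the names of each block
  choose nm hnm using hblocks
  set B := bl.length with hB
  let lo : Fin B → ℕ := fun β => (bl.get β).1
  let Dp : Fin B → ℕ := fun β => (bl.get β).2
  let names : Fin B → List (List ℕ × List ℕ) := fun β => nm (bl.get β) (List.get_mem _ _)
  have hchk : ∀ β, LinEDS.checkBlock k (lo β) (Dp β) (names β) = true := fun β => hnm _ _
  let C : Fin B → List ℕ := fun β => LinEDS.colsDepth k (lo β) (Dp β)
  let nb : Fin B → ℕ := fun β => (C β).length
  have hlen : ∀ β, (C β).length = (names β).length := fun β => ((blocksE13_checkBlock (hchk β)).1).symm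
  -- positions, names and columns
  let ν : (Σ β : Fin B, Fin (nb β)) → List ℕ × List ℕ := fun i => (names i.1).get (Fin.cast (hlen i.1) i.2)
  let col : (Σ β : Fin B, Fin (nb β)) → ℕ := fun j => (C j.1).get j.2
  have hvalid : ∀ i, LinEDS.validName k (ν i) = true :=
    fun i => (blocksE13_checkBlock (hchk i.1)).2.1 _ (List.get_mem _ _)
  have hcolC : ∀ j, col j ∈ C j.1 := fun j => List.get_mem _ _
  have hcolmem : ∀ j, col j ∈ LinEDS.cols k := fun j => (blocksE13_mem_colsDepth.mp (hcolC j)).1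
  obtain ⟨-, hcols, -, -⟩ := stub_cols_spec k hk
  -- every column lies in a block
  have hhead' : (bl.head hne).1 = 0 := by
    rw [List.head?_eq_some_head hne] at hhead
    simpa using hhead
  have hlast' : (bl.getLast?.map Prod.snd).getD 0 = (bl.getLast hne).2 := by
    rw [List.getLast?_eq_some_getLast hne]; rfl
  rw [hlast'] at hcov
  have hcolsurj : ∀ c ∈ LinEDS.cols k, ∃ j, col j = c := by
    intro c hc
    have hd1 : 1 ≤ LinEDS.popc k c := blocksE13_popc_pos (by omega) ((hcols c).mp hc).2.1
    have hd2 : LinEDS.popc k c ≤ (bl.getLast hne).2 := by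
      simp only [LinEDS.depthCovered, List.all_eq_true, Nat.ble_eq] at hcov
      exact hcov c hc
    obtain ⟨β, h1, h2⟩ := blocksE13_chain_cover bl hne hchain (LinEDS.popc k c) (by omega) hd2
    have hcC : c ∈ C β := blocksE13_mem_colsDepth.mpr ⟨hc, h1, h2⟩
    obtain ⟨y, hy⟩ := List.mem_iff_get.mp hcC
    exact ⟨⟨β, y⟩, hy⟩
  -- odd determinant, by blocks
  have hdet : Odd (Matrix.of fun i j => LinEDS.entry k (ν i) (col j)).det := by
    refine stub_blockDet_odd B nb _ (fun i j hij => ?_) (fun β => ?_)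
    · -- above the diagonal blocks the bit vanishes, so the entry is even
      rw [Matrix.of_apply, ← Int.not_odd_iff_even,
        ← (stub_rowBits_parity k _ (hvalid i)).1 (col j) (hcolmem j)]
      have hdepth : Dp i.1 < LinEDS.popc k (col j) :=
        lt_of_le_of_lt (blocksE13_chain_mono bl hchain hle i.1 j.1 hij)
          (blocksE13_mem_colsDepth.mp (hcolC j)).2.1
      have hhigher : col j ∈ LinEDS.colsDepth k (Dp i.1) k :=
        blocksE13_mem_colsDepth.mpr ⟨hcolmem j, hdepth, blocksE13_popc_le _ _⟩
      have hzero := (blocksE13_checkBlock (hchk i.1)).2.2.1 _ (List.get_mem _ (Fin.cast (hlen i.1) i.2))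
      have hbit := congrArg (·.testBit (col j)) hzero
      simp only [Nat.testBit_land, Nat.zero_testBit,
        (blocksE13_testBit_maskOf _ _).mpr hhigher, Bool.and_true] at hbit
      show ¬ (LinEDS.rowBits k (ν i)).testBit (col j) = true
      rw [hbit]; exact Bool.false_ne_true
    · -- the diagonal block
      exact blocksE13_diag_odd hk (hchk β) (hlen β)
  exact stub_leaf_of_oddDet k _ ν col hk hvalid hcolmem hcolsurj hdet s hs hw

end Summit.KontsevichZagierPeriods.FurushoPentagon.KernelModuloPeriodConjecture
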